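import Literature.MathematicalPhysics.QuantumLattice.WightmanAxioms
import Literature.Analysis.UnboundedOperators.HalfSpaceSpectrumPositiveEnergy
import HarnessLib

/-!
# The Wightman axioms: positivity of the energy (proofs layer over `WightmanAxioms.lean`)

Discharge of the named fact `Literature.MathematicalPhysics.QuantumLattice.IsWightmanQFT.hasPositiveEnergy`:
under the Wightman axioms the Hamiltonian of the time translations `U(t e₀, 1) = e^{itH}` is
positive, `H ≥ 0` (Streater–Wightman, *PCT, Spin and Statistics, and All That* (1964), §3-1: the
spectral condition `supp E ⊆ V̄₊`, eqs. (3-3)–(3-4), gives `P⁰ ≥ 0`).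

Only axiom W0's spectral condition `IsWightmanQFT.spectral : W.transl.HasFourierSpectrumIn V̄₊` is
used: the closed forward cone lies in the half-space `{p | 0 ≤ ⟪p, e₀⟫ = p⁰}`
(`inner_e₀_nonneg_of_mem_closedForwardCone`), and a half-space spectral condition makes the
generator of the translations along `e₀` positive
(`UnitaryRep.hasPositiveEnergy_alongDirection_of_hasFourierSpectrumIn`, proved in
`Literature/Analysis/UnboundedOperators/HalfSpaceSpectrumPositiveEnergy.lean` without the spectral
theorem, by smearing with Gårding kernels `𝓕⁻¹G` and a smooth square root of the energy symbol).

## References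

* R. F. Streater, A. S. Wightman, *PCT, Spin and Statistics, and All That* (1964), §3-1,
  spectral condition (3-3)–(3-4). [StreaterWightman1964]
-/

noncomputable section

open scoped InnerProductSpace RealInnerProductSpace

namespace Literature.MathematicalPhysics.QuantumLattice

variable {d : ℕ} {κ : Type*}

/-- On the closed forward cone the energy is non-negative: `0 ≤ ⟪p, e₀⟫ = p⁰` for `p ∈ V̄₊`
(`‖p⃗‖ ≤ p⁰`; Streater–Wightman (1964), §3-1). [cite: StreaterWightman1964, §3-1] -/
theorem inner_e₀_nonneg_of_mem_closedForwardCone {p : SpaceTime d} (hp : p ∈ closedForwardCone d) :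
    0 ≤ ⟪p, (EuclideanSpace.single (0 : Fin (d + 1)) (1 : ℝ) : SpaceTime d)⟫ := by
  rw [EuclideanSpace.inner_single_right]
  simp only [one_mul, conj_trivial]
  exact (norm_nonneg _).trans ((mem_closedForwardCone_iff p).1 hp)

namespace IsWightmanQFT

variable {W : WightmanData d κ}

/-- **Discharge** of `IsWightmanQFT.hasPositiveEnergy`: under the Wightman axioms the Hamiltonian
of the time translations `U(t e₀, 1) = e^{itH}` is positive, `0 ≤ ⟪x, H x⟫` on `D(H)` (and `H` is
symmetric) — the spectral condition `supp E ⊆ V̄₊` implies `p⁰ ≥ 0` (Streater–Wightman (1964),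
§3-1, (3-3)–(3-4)); here from W0's distributional spectral condition through
`UnitaryRep.hasPositiveEnergy_alongDirection_of_hasFourierSpectrumIn` with `e = e₀`
(`timeTranslations = alongDirection e₀`). [cite: StreaterWightman1964, §3-1] -/
theorem hasPositiveEnergy_holds : hasPositiveEnergy (W := W) := fun hW =>
  Literature.Analysis.UnboundedOperators.UnitaryRep.hasPositiveEnergy_alongDirection_of_hasFourierSpectrumIn
    W.transl hW.spectral (EuclideanSpace.single (0 : Fin (d + 1)) (1 : ℝ))
    fun _ hp => inner_e₀_nonneg_of_mem_closedForwardCone hp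

end IsWightmanQFT

end Literature.MathematicalPhysics.QuantumLattice
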